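import Literature.AnabelianGeometry.EtaleTheta.Discharge.Sec3Prop34CnstOfRlfQ
import Literature.AnabelianGeometry.EtaleTheta.Discharge.Sec3Prop34CnstOfRlfZWeak
import Literature.AnabelianGeometry.EtaleTheta.RealifiedDivisorMonoidsOfRlfQWeak
import Literature.AlgebraicGeometry.Frobenioids.RlfStructureWeak
import HarnessLib

/-!
# [EtTh] Prop 3.4 (ii) relative to `D^cnst` for the Def. 3.6 (i) data of monoid type `ℚ` over the WEAK
# vocabulary (`RealifiedDivisorMonoids.ofRlfQWeak`: `B₀^ℚ = B₀^pf`, `F₀^ℚ = F₀^pf`): what transports from the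
# `B₀`-level, and the exact residual

S. Mochizuki, *The étale theta function …*, Publ. RIMS **45** (2009) [EtTh], §3, Proposition 3.4 (ii)
PDF p.74, Definition 3.6 (i) p.76, Theorem 3.7 (iii) pp.79–80 of `paper:doi-10-2977-prims-1234361159`
[cite: MochizukiEtTh2009, Prop 3.4 (ii) p.74]:

> "`O_L^× ⥲ Ker(B₀(Y^log) → Φ₀^gp(Y^log))`; `O_L^▷ ⥲ B₀(Y^log) ×_{Φ₀^gp(Y^log)} Φ₀(Y^log)`;
> `L^× ⥲ F₀(Y^log) ⊆ B₀(Y^log)`" (Prop. 3.4 (ii)); "`B₀^Λ` for `B₀` (resp. `B₀^pf`; `ℝ·Φ₀^birat`) if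
> `Λ = ℤ` (resp. `ℚ`; `ℝ`), `F₀^Λ ⊆ B₀^Λ` for `F₀` (resp. `F₀^pf`; `ℝ·Φ₀^cnst`)" (Def. 3.6 (i)); "(iii) …
> If, moreover, `Λ ∈ {ℤ, ℚ}`, then this factorization determines a faithful action of the image of
> `Aut_C(A)` in `Aut_{D^cnst}(A^cnst)` on `O^▷(A)`, `O^×(A)`" (Thm. 3.7 (iii)).

WEAK-VOCABULARY TWIN of `Discharge/Sec3Prop34CnstOfRlfQ.lean` (abc-iut-w4-d084, row «hP34Λ at the
constructed Def. 3.6 (i) data», GAP-LEDGER G-w5d124-1), proof-only, at abc-iut-L6-t12's weak constructor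
`RealifiedDivisorMonoids.ofRlfQWeak dm hpf` (`RealifiedDivisorMonoidsOfRlfQWeak.lean`, p425661; `B₀^ℚ(Y) =
B₀(Y)^pf`, `F₀^ℚ(Y) = F₀(Y)^pf`, `B₀^ℚ → (Φ₀^ℝ)^gp` the extension `divQWeak` of `B₀ → Φ₀^gp → (Φ₀^rlf)^gp`;
hypothesis `hpf : ∀ Y, IsPerfFactorialCof (Φ₀ Y)` — abc-iut-L2-t3's repaired reading of Prop. 3.4 (i),
satisfiable at the tempered coverings `Ÿ`, `Z_∞` where the printed Prop. 3.4 (i) and hence `ofRlfQ` are VACUOUS,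
cell finding F-L2d2-1).  RESULT, clause by clause of `RealifiedDivisorMonoids.Prop34Cnst (ofRlfQWeak dm hpf) cnst`,
exactly as in the strong file:
* clause 1 — `hP34Λ` at monoid type `ℚ` — FOLLOWS from the `B₀`-level Prop. 3.4 (ii) (`DivisorMonoids.Prop34`,
  iso 2): for `b = a^{1/n}`, `(divQ b)^n = ι(div₀ a)` is effective, so `div₀ a` is effective in `Φ₀(Y)`
  (`RlfEffective.exists_eq_of_weak`: order embedding `Φ₀^pf ↪ Φ₀^rlf` for the WEAKLY perf-factorial `Φ₀(Y)`),
  hence `a ∈ F₀(Y)` and `b ∈ F₀(Y)^pf` (`ofRlfQWeak_mem_FΛ_of_divΛ_eq_of`);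
* clauses 2–3 (NATURALITY through `cnst`) FOLLOW from `Prop34Cnst₀`: roots are determined, and `n`-th powers
  are injective in the weak `Φ₀(Y)^rlf` (`IsPerfFactorialWeak.Rlf.isPerfect`);
* clause 4 (faithfulness, NON-vacuous at `Λ = ℚ`) enters BY NAME as the binder `hQ` (`B₀`-level faithfulness
  up to torsion), and `torsionFaithful_of_prop34Cnst_ofRlfQWeak` shows it is EXACTLY the residual — using the
  injectivity of `Φ₀^pf → Φ₀^rlf` for weakly perf-factorial monoids
  (`IsPerfFactorialWeak.Rlf.toRealification_injective`, from the order embedding of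
  `RealificationOrderWeak.lean` and sharpness/integrality of `Φ₀^pf`);
* `Prop34Cnst.ofRlfQWeak_of_torsionFaithful` / `Prop34Cnst.ofRlfQWeak` assemble;
  `TemperedFrobenioid.thm37_iii_withCnst_ofRlfQWeak` — Theorem 3.7 (iii), as typed, for every tempered
  Frobenioid over the weak `Λ = ℚ` data, modulo `Prop34` (iso 2), `Prop34Cnst₀` and `hQ`.
The strong file's `torsionFaithful_of_prop34Cnst₀_of_torsionFree` (a `B₀`-level statement, no `hpf`) is
vocabulary-free and is consumed BY NAME where wanted; nothing of abc-iut-w4-d084's file is edited or restated.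
Seat abc-iut-L6-t12 (gen 4), cell abc-iut, row «§3 WEAK COLUMN at Λ = ℚ/ℝ» piece (W2-Q).  PROOF-ONLY (0 defs).
HONEST FRAMING: refereed pre-IUT material ([EtTh] 2009); nothing here bears on [IUTchIII] Cor. 3.12; no
statement of the paper is strengthened; typed ≠ proved — clause 4 for `Λ = ℚ` stays a named hypothesis.
-/

noncomputable section

/-! ### `Φ₀^pf → Φ₀^rlf` is injective for WEAKLY perf-factorial monoids -/

namespace Literature.AlgebraicGeometry.Frobenioids

open Literature.AnabelianGeometry.EtaleTheta

/-- **`ι : M^pf → M^rlf` is injective for a WEAKLY perf-factorial monoid `M`** ([FrdI] Def. 2.4 (i): the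
realification is built from the order-preserving embeddings `M_𝔭 ↪ ℝ_{≥0}`): `ι` reflects divisibility
(`RlfCoordWeak.toRealification_dvd_iff`, the order embedding (d_ord) of the weak notion), and `M^pf` is sharp and
integral (`IsDivisorial.perfection`), so mutually dividing elements coincide.  Weak twin of
`IsPerfFactorial.Rlf.toRealification_injective`. [cite: MochizukiFrdI2008, Def. 2.4(i) p.48] -/
theorem IsPerfFactorialWeak.Rlf.toRealification_injective {M : Type*} [CommMonoid M]
    (hP : IsPerfFactorialWeak M) : Function.Injective hP.toRealification := by
  have hcancel : IsCancelMul (Perfection M) :=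
    isIntegral_iff_isCancelMul.mp hP.isDivisorial.perfection.isPreDivisorial.isIntegral
  intro a b h
  have hmono := fun 𝔮 => RlfCoordWeak.isMonoprime_pfAt hP 𝔮
  have h₁ : a ∣ b := (RlfCoordWeak.toRealification_dvd_iff hP hmono a b).mp (h ▸ dvd_refl _)
  have h₂ : b ∣ a := (RlfCoordWeak.toRealification_dvd_iff hP hmono b a).mp (h ▸ dvd_refl _)
  exact @dvd_antisymm_of_isSharp _ _ hP.isDivisorial.perfection.isSharp hcancel _ _ h₁ h₂

end Literature.AlgebraicGeometry.Frobenioids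

namespace Literature.AnabelianGeometry.EtaleTheta

open CategoryTheory Opposite Literature.AlgebraicGeometry.Frobenioids

universe u₀ v₀ u₁ v₁ u v w

namespace RealifiedDivisorMonoids.Prop34Cnst

variable {D₀ : Type u} [Category.{v} D₀] {dm : DivisorMonoids.{u, v, w} D₀}
  {hpf : ∀ Y : D₀ᵒᵖ, IsPerfFactorialCof (dm.Φ₀.obj Y)}
  {Dcnst : Type u₁} [Category.{v₁} Dcnst] {cnst : D₀ ⥤ Dcnst}

/-! ### Roots: the image of `a^{1/n} ∈ B₀(Y)^pf` raised to the `n`-th power is the image of `a` -/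

/-- For `b = a^{1/n} ∈ B₀(Y)^pf`: `(divQ b)^n = ι(div₀ a)` in `(Φ₀(Y)^rlf)^gp` (weak `Φ₀(Y)`) — the `Λ = ℚ`
divisor map on roots is determined by the `Λ = ℤ` one. [cite: MochizukiEtTh2009, Def 3.6 p.76] -/
theorem divQWeak_mk_pow (Y : D₀ᵒᵖ) (a : dm.B₀.obj Y) (n : ℕ+) :
    divQWeak dm hpf Y (Perfection.mk a n) ^ (n : ℕ) =
      gpMap ((toRlfNatTransWeak dm.Φ₀ hpf).app Y).hom (dm.div₀ Y a) := by
  rw [← map_pow, Perfection.mk_pow_self, divQWeak_of]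
  rfl

/-- If `b = a^{1/n} ∈ B₀(Y)^pf` maps to (the image of) `x ∈ Φ₀(Y)^rlf` (weak), then `div₀ a` maps to `x^n`.
[cite: MochizukiEtTh2009, Prop 3.4 (ii) p.74] -/
theorem gpMap_div₀_eq_of_pow_weak (Y : D₀ᵒᵖ) (a : dm.B₀.obj Y) (n : ℕ+)
    (x : (rlfFunctorWeak dm.Φ₀ hpf).obj Y)
    (hbx : divQWeak dm hpf Y (Perfection.mk a n) = Algebra.GrothendieckGroup.of x) :
    gpMap ((toRlfNatTransWeak dm.Φ₀ hpf).app Y).hom (dm.div₀ Y a) =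
      Algebra.GrothendieckGroup.of (x ^ (n : ℕ)) := by
  have h := divQWeak_mk_pow (dm := dm) (hpf := hpf) Y a n
  rw [hbx, ← map_pow] at h
  exact h.symm

/-- Hence, for `b = a^{1/n} ∈ B₀(Y)^pf` with EFFECTIVE image `x` in `(Φ₀(Y)^rlf)^gp` (weak `Φ₀(Y)`): the
log-divisor `div₀ a` is effective in `Φ₀(Y)` itself — `div₀ a = [x₀]` with `ι(x₀) = x^n` — by
`RlfEffective.exists_eq_of_weak`. [cite: MochizukiEtTh2009, Prop 3.4 (ii) p.74] -/
theorem exists_div₀_eq_of_divQWeak_mk_eq_of (Y : D₀ᵒᵖ) (a : dm.B₀.obj Y) (n : ℕ+)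
    (x : (rlfFunctorWeak dm.Φ₀ hpf).obj Y)
    (hbx : divQWeak dm hpf Y (Perfection.mk a n) = Algebra.GrothendieckGroup.of x) :
    ∃ x₀ : dm.Φ₀.obj Y, dm.div₀ Y a = Algebra.GrothendieckGroup.of x₀ ∧
      x ^ (n : ℕ) = (hpf Y).weak.toRealification (Perfection.of _ x₀) :=
  RlfEffective.exists_eq_of_weak (hpf Y).weak (dm.div₀ Y a) (x ^ (n : ℕ))
    (gpMap_div₀_eq_of_pow_weak Y a n x hbx)

/-! ### Clause 1: `hP34Λ` at monoid type `ℚ` -/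

/-- **Prop. 3.4 (ii), iso 2, at monoid type `ℚ` for the CONSTRUCTED weak data** (`hP34Λ` at
`T = ofRlfQWeak dm hpf`): an element of `B₀^ℚ(Y) = B₀(Y)^pf` whose image in `(Φ₀^ℝ)^gp(Y) = (Φ₀(Y)^rlf)^gp` is
effective lies in `F₀^ℚ(Y) = F₀(Y)^pf` — from the `B₀`-level clause "`O_L^▷ ⥲ B₀ ×_{Φ₀^gp} Φ₀ ⊆ F₀`" applied to
the radicand. [cite: MochizukiEtTh2009, Prop 3.4 (ii) p.74] -/
theorem ofRlfQWeak_mem_FΛ_of_divΛ_eq_of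
    (h34 : ∀ (Y : D₀ᵒᵖ) (b : dm.B₀.obj Y) (x : dm.Φ₀.obj Y),
      dm.div₀ Y b = Algebra.GrothendieckGroup.of x → b ∈ dm.F₀ Y)
    (Y : D₀ᵒᵖ) (b : (RealifiedDivisorMonoids.ofRlfQWeak dm hpf).BΛ.obj Y)
    (x : (RealifiedDivisorMonoids.ofRlfQWeak dm hpf).ΦR.obj Y)
    (hbx : (RealifiedDivisorMonoids.ofRlfQWeak dm hpf).divΛ Y b = Algebra.GrothendieckGroup.of x) :
    b ∈ (RealifiedDivisorMonoids.ofRlfQWeak dm hpf).FΛ Y := by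
  obtain ⟨⟨a, n⟩, rfl⟩ := Perfection.mk_surjective b
  change divQWeak dm hpf Y (Perfection.mk a n) = Algebra.GrothendieckGroup.of x at hbx
  obtain ⟨x₀, hx₀, -⟩ := exists_div₀_eq_of_divQWeak_mk_eq_of Y a n x hbx
  have ha : a ∈ dm.F₀ Y := h34 Y a x₀ hx₀
  -- `a^{1/n} = ((a : F₀)^{1/n})` lies in the image of `F₀(Y)^pf → B₀(Y)^pf`
  change Perfection.mk a n ∈ MonoidHom.mrange (Perfection.map (dm.F₀ Y).subtype)
  exact ⟨Perfection.mk ⟨a, ha⟩ n, rfl⟩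

/-- The same from the typed Prop. 3.4 hypothesis structure `DivisorMonoids.Prop34` (any vocabulary).
[cite: MochizukiEtTh2009, Prop 3.4 (ii) p.74] -/
theorem ofRlfQWeak_mem_FΛ_of_divΛ_eq_of' {V : FrdIMonoidStub.{w}} {V₀ : FrdICatStub.{u, v, w} D₀}
    (h34 : dm.Prop34 V V₀) (Y : D₀ᵒᵖ) (b : (RealifiedDivisorMonoids.ofRlfQWeak dm hpf).BΛ.obj Y)
    (x : (RealifiedDivisorMonoids.ofRlfQWeak dm hpf).ΦR.obj Y)
    (hbx : (RealifiedDivisorMonoids.ofRlfQWeak dm hpf).divΛ Y b = Algebra.GrothendieckGroup.of x) :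
    b ∈ (RealifiedDivisorMonoids.ofRlfQWeak dm hpf).FΛ Y :=
  ofRlfQWeak_mem_FΛ_of_divΛ_eq_of h34.mem_F₀_of_div₀_mem Y b x hbx

/-! ### Clauses 2–3: naturality through `cnst` transports to the perfection -/

/-- **Clause 2 at `Λ = ℚ` (weak data)**: morphisms `g, g'` of `D₀` with the same image in `D^cnst` pull back
every element of `F₀^ℚ(Y') = F₀(Y')^pf` identically — `B₀^pf(g)` acts on `a^{1/n}` through `B₀(g) a`.
[cite: MochizukiEtTh2009, Prop 3.4 (ii) p.74] -/
theorem ofRlfQWeak_BΛ_map_eq (h₀ : dm.Prop34Cnst₀ cnst) {Y Y' : D₀} (g g' : Y ⟶ Y')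
    (hg : cnst.map g = cnst.map g') (b : (RealifiedDivisorMonoids.ofRlfQWeak dm hpf).BΛ.obj (op Y'))
    (hb : b ∈ (RealifiedDivisorMonoids.ofRlfQWeak dm hpf).FΛ (op Y')) :
    ((RealifiedDivisorMonoids.ofRlfQWeak dm hpf).BΛ.map g.op).hom b =
      ((RealifiedDivisorMonoids.ofRlfQWeak dm hpf).BΛ.map g'.op).hom b := by
  obtain ⟨xF, rfl⟩ := hb
  obtain ⟨⟨a, n⟩, rfl⟩ := Perfection.mk_surjective xF
  change Perfection.map (dm.B₀.map g.op).hom (Perfection.map (dm.F₀ (op Y')).subtype (Perfection.mk a n)) =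
    Perfection.map (dm.B₀.map g'.op).hom (Perfection.map (dm.F₀ (op Y')).subtype (Perfection.mk a n))
  rw [Perfection.map_mk, Perfection.map_mk, Perfection.map_mk]
  exact congrArg (Perfection.mk · n) (h₀.B₀_map_eq_of_cnst_map_eq g g' hg (a : dm.B₀.obj (op Y')) a.2)

/-- **Clause 3 at `Λ = ℚ` (weak data)**: morphisms `g, g'` with the same image in `D^cnst` pull back
identically every `x ∈ Φ₀(Y')^rlf` that is the image of an element of `F₀(Y')^pf` — `x^n = ι(x₀)` for a
log-divisor `x₀` of a constant, on which `Prop34Cnst₀.Φ₀_map_eq_of_cnst_map_eq` applies, and `n`-th powers are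
injective in the weak `Φ₀(Y)^rlf` (`IsPerfFactorialWeak.Rlf.isPerfect`). [cite: MochizukiEtTh2009, Prop 3.4 (ii) p.74] -/
theorem ofRlfQWeak_ΦR_map_eq (h₀ : dm.Prop34Cnst₀ cnst) {Y Y' : D₀} (g g' : Y ⟶ Y')
    (hg : cnst.map g = cnst.map g') (x : (RealifiedDivisorMonoids.ofRlfQWeak dm hpf).ΦR.obj (op Y'))
    (hx : ∃ b ∈ (RealifiedDivisorMonoids.ofRlfQWeak dm hpf).FΛ (op Y'),
      (RealifiedDivisorMonoids.ofRlfQWeak dm hpf).divΛ (op Y') b = Algebra.GrothendieckGroup.of x) :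
    ((RealifiedDivisorMonoids.ofRlfQWeak dm hpf).ΦR.map g.op).hom x =
      ((RealifiedDivisorMonoids.ofRlfQWeak dm hpf).ΦR.map g'.op).hom x := by
  obtain ⟨b, ⟨xF, rfl⟩, hbx⟩ := hx
  obtain ⟨⟨a, n⟩, rfl⟩ := Perfection.mk_surjective xF
  change divQWeak dm hpf (op Y') (Perfection.mk (a : dm.B₀.obj (op Y')) n) = Algebra.GrothendieckGroup.of x
    at hbx
  obtain ⟨x₀, hx₀, hxn⟩ := exists_div₀_eq_of_divQWeak_mk_eq_of (op Y') (a : dm.B₀.obj (op Y')) n x hbx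
  -- `Φ₀(g) x₀ = Φ₀(g') x₀` for the log-divisor of the constant `a`
  have hΦ : (dm.Φ₀.map g.op).hom x₀ = (dm.Φ₀.map g'.op).hom x₀ :=
    h₀.Φ₀_map_eq_of_cnst_map_eq g g' hg x₀ ⟨(a : dm.B₀.obj (op Y')), a.2, hx₀⟩
  -- work with the weak realification functor itself (`T.ΦR = rlfFunctorWeak Φ₀` definitionally)
  change ((rlfFunctorWeak dm.Φ₀ hpf).map g.op).hom x = ((rlfFunctorWeak dm.Φ₀ hpf).map g'.op).hom x
  -- the `n`-th powers of the two pull-backs agree: they are the pull-backs of `ι(x₀)`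
  have key : ((rlfFunctorWeak dm.Φ₀ hpf).map g.op).hom x ^ (n : ℕ) =
      ((rlfFunctorWeak dm.Φ₀ hpf).map g'.op).hom x ^ (n : ℕ) := by
    rw [← map_pow, ← map_pow, hxn]
    change rlfMapWeak dm.Φ₀ hpf g.op ((hpf (op Y')).weak.toRealification (Perfection.of _ x₀)) =
      rlfMapWeak dm.Φ₀ hpf g'.op ((hpf (op Y')).weak.toRealification (Perfection.of _ x₀))
    rw [rlfMapWeak_toRealification_of, rlfMapWeak_toRealification_of, hΦ]
  -- `n`-th powers are injective in the weak `Φ₀(Y)^rlf`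
  exact ((IsPerfFactorialWeak.Rlf.isPerfect (hpf (op Y)).weak).bijective_pow (n : ℕ) n.pos).1 key

/-! ### Clause 4: faithfulness up to torsion is the exact residual -/

/-- From the `B₀`-level faithfulness UP TO TORSION (the binder `hQ`): automorphisms of `Y` acting identically on
`Ker(B₀(Y)^pf → (Φ₀^rlf)^gp(Y))` have the same image in `Aut_{D^cnst}(Y^cnst)` (weak data).
[cite: MochizukiEtTh2009, Thm 3.7 (iii) p.80] -/
theorem ofRlfQWeak_cnst_map_eq
    (hQ : ∀ {Y : D₀} (g g' : Y ≅ Y),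
      (∀ b : dm.B₀.obj (op Y), dm.div₀ (op Y) b = 1 →
        ∃ N : ℕ+, ((dm.B₀.map g.hom.op).hom b) ^ (N : ℕ) = ((dm.B₀.map g'.hom.op).hom b) ^ (N : ℕ)) →
      cnst.map g.hom = cnst.map g'.hom)
    {Y : D₀} (g g' : Y ≅ Y)
    (hker : ∀ b : (RealifiedDivisorMonoids.ofRlfQWeak dm hpf).BΛ.obj (op Y),
      (RealifiedDivisorMonoids.ofRlfQWeak dm hpf).divΛ (op Y) b = 1 →
        ((RealifiedDivisorMonoids.ofRlfQWeak dm hpf).BΛ.map g.hom.op).hom b =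
          ((RealifiedDivisorMonoids.ofRlfQWeak dm hpf).BΛ.map g'.hom.op).hom b) :
    cnst.map g.hom = cnst.map g'.hom := by
  refine hQ g g' fun b hb => ?_
  have h1 : (RealifiedDivisorMonoids.ofRlfQWeak dm hpf).divΛ (op Y) (Perfection.of _ b) = 1 := by
    change divQWeak dm hpf (op Y) (Perfection.of _ b) = 1
    rw [divQWeak_of]
    change gpMap ((toRlfNatTransWeak dm.Φ₀ hpf).app (op Y)).hom (dm.div₀ (op Y) b) = 1
    rw [hb, map_one]
  have h2 := hker (Perfection.of _ b) h1
  change Perfection.map (dm.B₀.map g.hom.op).hom (Perfection.of _ b) =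
    Perfection.map (dm.B₀.map g'.hom.op).hom (Perfection.of _ b) at h2
  rw [Perfection.of_apply, Perfection.map_mk, Perfection.map_mk, ← Perfection.of_apply,
    ← Perfection.of_apply, Perfection.of_eq_of_iff] at h2
  exact h2

/-- **Conversely, `hQ` is NECESSARY** (weak data): the faithfulness clause of `Prop34Cnst (ofRlfQWeak dm hpf) cnst`
yields the `B₀`-level faithfulness up to torsion.  So the residual of clause 4 at `Λ = ℚ` is EXACTLY `hQ`.
[cite: MochizukiEtTh2009, Thm 3.7 (iii) p.80] -/
theorem torsionFaithful_of_prop34Cnst_ofRlfQWeak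
    (h : (RealifiedDivisorMonoids.ofRlfQWeak dm hpf).Prop34Cnst cnst) {Y : D₀} (g g' : Y ≅ Y)
    (hb : ∀ b : dm.B₀.obj (op Y), dm.div₀ (op Y) b = 1 →
      ∃ N : ℕ+, ((dm.B₀.map g.hom.op).hom b) ^ (N : ℕ) = ((dm.B₀.map g'.hom.op).hom b) ^ (N : ℕ)) :
    cnst.map g.hom = cnst.map g'.hom := by
  refine h.cnst_map_eq_of_BΛ_map_eq (Or.inr rfl) g g' fun b' hb' => ?_
  obtain ⟨⟨a, n⟩, rfl⟩ := Perfection.mk_surjective b'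
  change divQWeak dm hpf (op Y) (Perfection.mk a n) = 1 at hb'
  -- `div₀ a = 1`: its image `ι(div₀ a) = (divQ a^{1/n})^n = 1` is effective, so `div₀ a = [x₀]` with `ι x₀ = 1`
  obtain ⟨x₀, hx₀, hxn⟩ := exists_div₀_eq_of_divQWeak_mk_eq_of (op Y) a n
    (1 : (rlfFunctorWeak dm.Φ₀ hpf).obj (op Y)) (hb'.trans (map_one _).symm)
  rw [one_pow] at hxn
  have hx₀1 : x₀ = 1 := by
    have hinj : Function.Injective
        ((hpf (op Y)).weak.toRealification.comp (Perfection.of (dm.Φ₀.obj (op Y)))) :=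
      (IsPerfFactorialWeak.Rlf.toRealification_injective (hpf (op Y)).weak).comp
        (of_injective_of_isSharp_isIntegral_isSaturated (hpf (op Y)).weak.isDivisorial.isSharp
          (hpf (op Y)).weak.isDivisorial.isPreDivisorial.isIntegral
          (hpf (op Y)).weak.isDivisorial.isPreDivisorial.isSaturated)
    apply hinj
    rw [map_one]
    exact hxn.symm
  rw [hx₀1, map_one] at hx₀
  obtain ⟨N, hN⟩ := hb a hx₀
  -- equality in `B₀(Y)^pf` of the pull-backs of `a^{1/n}`
  change Perfection.map (dm.B₀.map g.hom.op).hom (Perfection.mk a n) =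
    Perfection.map (dm.B₀.map g'.hom.op).hom (Perfection.mk a n)
  rw [Perfection.map_mk, Perfection.map_mk, Perfection.mk_eq_mk_iff]
  exact ⟨N, by rw [pow_mul, pow_mul, hN]⟩

/-! ### Assembly -/

/-- **Prop. 3.4 (ii) relative to `D^cnst` for the constructed WEAK Def. 3.6 (i) data of monoid type `ℚ`**: for
`T = ofRlfQWeak dm hpf`, `Prop34Cnst T cnst` follows from the typed Prop. 3.4 (ii) at the `B₀`-level (iso 2),
the `B₀`-level naturality clauses `Prop34Cnst₀ cnst`, and the `B₀`-level faithfulness up to torsion `hQ`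
(exactly necessary by `torsionFaithful_of_prop34Cnst_ofRlfQWeak`). [cite: MochizukiEtTh2009, Prop 3.4 (ii) p.74] -/
theorem ofRlfQWeak_of_torsionFaithful
    (h34 : ∀ (Y : D₀ᵒᵖ) (b : dm.B₀.obj Y) (x : dm.Φ₀.obj Y),
      dm.div₀ Y b = Algebra.GrothendieckGroup.of x → b ∈ dm.F₀ Y)
    (h₀ : dm.Prop34Cnst₀ cnst)
    (hQ : ∀ {Y : D₀} (g g' : Y ≅ Y),
      (∀ b : dm.B₀.obj (op Y), dm.div₀ (op Y) b = 1 →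
        ∃ N : ℕ+, ((dm.B₀.map g.hom.op).hom b) ^ (N : ℕ) = ((dm.B₀.map g'.hom.op).hom b) ^ (N : ℕ)) →
      cnst.map g.hom = cnst.map g'.hom) :
    (RealifiedDivisorMonoids.ofRlfQWeak dm hpf).Prop34Cnst cnst where
  mem_FΛ_of_divΛ_eq_of := ofRlfQWeak_mem_FΛ_of_divΛ_eq_of h34
  BΛ_map_eq_of_cnst_map_eq g g' hg b hb := ofRlfQWeak_BΛ_map_eq h₀ g g' hg b hb
  ΦR_map_eq_of_cnst_map_eq g g' hg x hx := ofRlfQWeak_ΦR_map_eq h₀ g g' hg x hx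
  cnst_map_eq_of_BΛ_map_eq _ _ g g' hker := ofRlfQWeak_cnst_map_eq hQ g g' hker

/-- The same with the typed `DivisorMonoids.Prop34` (any vocabulary) as input.
[cite: MochizukiEtTh2009, Prop 3.4 (ii) p.74] -/
theorem ofRlfQWeak {V : FrdIMonoidStub.{w}} {V₀ : FrdICatStub.{u, v, w} D₀} (h34 : dm.Prop34 V V₀)
    (h₀ : dm.Prop34Cnst₀ cnst)
    (hQ : ∀ {Y : D₀} (g g' : Y ≅ Y),
      (∀ b : dm.B₀.obj (op Y), dm.div₀ (op Y) b = 1 →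
        ∃ N : ℕ+, ((dm.B₀.map g.hom.op).hom b) ^ (N : ℕ) = ((dm.B₀.map g'.hom.op).hom b) ^ (N : ℕ)) →
      cnst.map g.hom = cnst.map g'.hom) :
    (RealifiedDivisorMonoids.ofRlfQWeak dm hpf).Prop34Cnst cnst :=
  ofRlfQWeak_of_torsionFaithful h34.mem_F₀_of_div₀_mem h₀ hQ

/-- At the weak `Λ = ℚ` data, if `B₀(Y)` has no torsion beyond `1` on `Ker(div₀)`, then `Prop34Cnst` follows from
`Prop34` + `Prop34Cnst₀` ALONE — `hQ` being supplied by the strong file's vocabulary-free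
`torsionFaithful_of_prop34Cnst₀_of_torsionFree` (consumed BY NAME). [cite: MochizukiEtTh2009, Thm 3.7 (iii) p.80] -/
theorem ofRlfQWeak_of_torsionFree {V : FrdIMonoidStub.{w}} {V₀ : FrdICatStub.{u, v, w} D₀}
    (h34 : dm.Prop34 V V₀) (h₀ : dm.Prop34Cnst₀ cnst)
    (htf : ∀ (Y : D₀) (u : dm.B₀.obj (op Y)) (N : ℕ+), dm.div₀ (op Y) u = 1 → u ^ (N : ℕ) = 1 → u = 1) :
    (RealifiedDivisorMonoids.ofRlfQWeak dm hpf).Prop34Cnst cnst :=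
  ofRlfQWeak h34 h₀ fun g g' hb => torsionFaithful_of_prop34Cnst₀_of_torsionFree h₀ htf g g' hb

end RealifiedDivisorMonoids.Prop34Cnst

/-! ### Theorem 3.7 (iii) over the constructed weak data of monoid type `ℚ` -/

namespace TemperedFrobenioid

variable {D₀ : Type u} [Category.{v} D₀] {dm : DivisorMonoids.{u, v, w} D₀}
  {hpf : ∀ Y : D₀ᵒᵖ, IsPerfFactorialCof (dm.Φ₀.obj Y)} {V : FrdIMonoidStub.{w}}
  {V₀ : FrdICatStub.{u, v, w} D₀} {D : Type u₀} [Category.{v₀} D] {VD : FrdICatStub.{u₀, v₀, w} D}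
  (C₀ : TemperedFrobenioid (RealifiedDivisorMonoids.ofRlfQWeak dm hpf) D VD)
  {Dcnst : Type u₁} [Category.{v₁} Dcnst] {cnst : D₀ ⥤ Dcnst}

/-- **Theorem 3.7 (iii) for a tempered Frobenioid (of monoid type `ℚ`) over the CONSTRUCTED weak Def. 3.6 (i)
data `ofRlfQWeak dm hpf`**, at the instantiated facade, modulo statements about the Def. 3.3 (iii) data only:
the typed Prop. 3.4 (ii) `dm.Prop34`, its naturality clauses `dm.Prop34Cnst₀ cnst`, and the `B₀`-level
faithfulness up to torsion `hQ` — the weak twin of `thm37_iii_withCnst_ofRlfQ`.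
[cite: MochizukiEtTh2009, Thm 3.7 (iii) p.79] -/
theorem thm37_iii_withCnst_ofRlfQWeak (F : FrobenioidFacade.{u₀, v₀, w} D) (h34 : dm.Prop34 V V₀)
    (h₀ : dm.Prop34Cnst₀ cnst)
    (hQ : ∀ {Y : D₀} (g g' : Y ≅ Y),
      (∀ b : dm.B₀.obj (op Y), dm.div₀ (op Y) b = 1 →
        ∃ N : ℕ+, ((dm.B₀.map g.hom.op).hom b) ^ (N : ℕ) = ((dm.B₀.map g'.hom.op).hom b) ^ (N : ℕ)) →
      cnst.map g.hom = cnst.map g'.hom) :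
    TemperedFrobenioid.Thm37_iii (T := RealifiedDivisorMonoids.ofRlfQWeak dm hpf) C₀
      (F.withCnst (C₀.base ⋙ cnst)) :=
  C₀.thm37_iii_withCnst F (RealifiedDivisorMonoids.Prop34Cnst.ofRlfQWeak h34 h₀ hQ)

end TemperedFrobenioid

end Literature.AnabelianGeometry.EtaleTheta

end
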